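import Summits.AtomisticToContinuum.HydrodynamicLimit.Theorems.BoxDissipativeWeakStrongEntropyAdmissibilityStubStaticEntropyFunctionalsLLN

/-!
# Crux `EntropyAdmissibility` (stmt-AtomisticToContinuum-9903), line `registered` — stub `stub_fsEntropyFunctionalsLLN`

FS1 of the lead's skeleton (r13): the law of large numbers AT A GENERAL FLOW-TIME `t ∈ [0, T)` for
the two entropy functionals that make up the bulk integrand of the clamp-renormalised entropy
balance — the density-weighted clamped entropy `ρ̂_t Z_{a,b}(ŝ_t) ψ` and the entropy flux
`Z_{a,b}(ŝ_t) m̂_t·Ψ` — tested against ARBITRARY continuous data `ψ : 𝕋³ → ℝ`, `Ψ : 𝕋³ → ℝ³`,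
for general profiles, in the crux's own quantifier frame `EABirthCore.InFrame`, CONDITIONALLY on the
fine-scale law of large numbers at time `t` (the box fields at time `t` converge in `L¹(P_N ⊗ dx)`
to the Euler state `(ρ, ρu, E)(t, ·)`):

  `E_{P_N} |∫ ρ̂_t Z(ŝ_t) ψ dx − ∫ ρ_t Z(s_t) ψ dx| → 0`,
  `E_{P_N} |∫ Z(ŝ_t) m̂_t·Ψ dx − ∫ Z(s_t) ρ_t u_t·Ψ dx| → 0`   (`s_t = s_cut(ρ(t,·), θ(t,·))`).

This is the landed GE1 (`EABirthGE1.stub_staticEntropyFunctionalsLLN`, flow-time `0`, where the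
fine-scale LLN came from `LGFS.localGibbsFineScale_of_pos`) with `0 ↦ t` and the LLN taken as the
hypothesis of the conclusion `Cge1t`.

Proof (the GE1 / S0b template over the landed modulus `EABirthS0a.stub_entropyModulus`). Thresholds
`η_c := η₀` of `HsEosLowDensity` (so `f_ex` is continuous on `[0, η₀)`), `σ₀ := 1/2`. With
`G(q) = Z_{a,b}(s_cut(q.1, θ̂(q)))`, `|G| ≤ M = |a| ∨ |b|`, the compact set of Euler data states
`K = range (x ↦ U_t(x) = (ρ_t, ρ_t u_t, E_t)(x))` (in the band, `θ̂(U_t) = θ_t`), the `δ` of S0a at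
accuracy `ε'` and `dev = |ρ̂ − ρ_t| + ‖m̂ − ρ_t u_t‖ + |Ê − E_t| ≥ dist(Û, U_t)`:
`|G(Û) − G(U_t)| ≤ ε' + (2M/δ) dev` (`EABirthS0b.abs_sub_le_of_modulus`), whence pointwise
`|ρ̂ G(Û) ψ − ρ_t G(U_t) ψ| ≤ B R ε' + B (M + 2MR/δ) dev` (`B = sup |ψ|`, `R = sup ρ_t`) and
`|G(Û)⟪m̂,Ψ⟫ − G(U_t)⟪m_t,Ψ⟫| ≤ S R_m ε' + S (M + 2M R_m/δ) dev` (`S = sup ‖Ψ‖`, `R_m = sup ‖ρ_t u_t‖`,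
`EABirthGE1.abs_mul_sub_mul_le`). Both are `≤ ε + C dev`; the integrands are integrable in `x`, and
`E_{P_N} ofReal(∫ dev dx) → 0` is the hypothesis; conclude with the abstract squeeze
`EABirthS0b.tendsto_lintegral_abs_integral_sub`.

References: J. Březina, E. Feireisl, J. Math. Soc. Japan 70 (2018), Def. 2.9, §3.2;
H. Spohn, *Large Scale Dynamics of Interacting Particles* (1991), Part I Ch. 3.
-/

noncomputable section

open MeasureTheory Filter Set
open scoped ENNReal Topology

namespace Summit.AtomisticToContinuum.HydrodynamicLimit.Theorems.EABirthFS1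

open Literature.MathematicalPhysics.KineticTheory
open Literature.Analysis.FluidPDE.CompressibleEuler (clamp abs_clamp_le)
open Summit.AtomisticToContinuum.HydrodynamicLimit.Theses
open Summit.AtomisticToContinuum.HydrodynamicLimit.Theorems.BDWS
open Summit.AtomisticToContinuum.HydrodynamicLimit.Theorems.EABirthCore (Conclusion InFrame)
open Summit.AtomisticToContinuum.HydrodynamicLimit.Theorems.EABirthS0b (abs_sub_le_of_modulus
  abs_mul_mul_sub_le dist_le_sum3 measurable_boxTemp measurable_clamp_cutEntropy measurable_boxFields
  integrable_boxFields boxDensity_nonneg tendsto_lintegral_abs_integral_sub)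
open Summit.AtomisticToContinuum.HydrodynamicLimit.Theorems.EABirthGE1 (abs_mul_sub_mul_le)

/-! ## The stub -/

/-- **Conclusion `Cge1t` — GE1 at time `t` under the time-`t` fine-scale LLN** (verbatim the
skeleton's): for every `t ∈ [0,T)`, IF the box fields at time `t` converge in `L¹(P_N ⊗ dx)` to the
Euler state at `t`, THEN the two entropy functionals at time `t` converge:
`E|∫ ρ̂_t Z(ŝ_t) ψ − ∫ ρ_t Z(s_t) ψ| → 0`, `E|∫ Z(ŝ_t) m̂_t·Ψ − ∫ Z(s_t) ρ_t u_t·Ψ| → 0`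
(`s_t = s_cut(ρ(t,x), θ(t,x))`). -/
def Cge1t : Conclusion := fun σ η₁ a₀ θ₀ u₀ T ρ θ u Φ ℓ _τ a b _φ =>
  ∀ t ∈ Ico 0 T,
    Tendsto (fun N : ℕ => ∫⁻ z, ENNReal.ofReal (∫ x,
        (|boxDensity σ ℓ Φ N t z x - ρ t x| + ‖boxMomentum σ ℓ Φ N t z x - ρ t x • u t x‖ +
          |boxEnergy σ ℓ Φ N t z x - totalEnergyDensity (ρ t x) (u t x) (θ t x)|))
      ∂(localGibbsLaw σ a₀ u₀ θ₀ N (Φ N))) atTop (𝓝 0) →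
    (∀ ψ : T3 → ℝ, Continuous ψ →
      Tendsto (fun N : ℕ => ∫⁻ z, ENNReal.ofReal
          |(∫ x, boxDensity σ ℓ Φ N t z x * boxClampedEntropy σ η₁ ℓ Φ a b N t z x * ψ x) -
            ∫ x, ρ t x * clamp a b (cutEntropy σ η₁ (ρ t x) (θ t x)) * ψ x|
        ∂(localGibbsLaw σ a₀ u₀ θ₀ N (Φ N))) atTop (𝓝 0)) ∧
    (∀ Ψ : T3 → V3, Continuous Ψ →
      Tendsto (fun N : ℕ => ∫⁻ z, ENNReal.ofReal
          |(∫ x, boxClampedEntropy σ η₁ ℓ Φ a b N t z x * inner ℝ (boxMomentum σ ℓ Φ N t z x) (Ψ x)) -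
            ∫ x, clamp a b (cutEntropy σ η₁ (ρ t x) (θ t x)) * inner ℝ (ρ t x • u t x) (Ψ x)|
        ∂(localGibbsLaw σ a₀ u₀ θ₀ N (Φ N))) atTop (𝓝 0))

/-- Signature of FS1 (verbatim the skeleton's). -/
def Sig.stub_fsEntropyFunctionalsLLN : Prop :=
  InFrame Cge1t

/-- **Stub FS1** (crux stmt-AtomisticToContinuum-9903, line `registered`): the law of large numbers
at a general flow-time `t ∈ [0, T)` for the two entropy functionals `ρ̂_t Z(ŝ_t) ψ` and
`Z(ŝ_t) m̂_t·Ψ`, general profiles, arbitrary continuous test data — from the landed modulus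
`EABirthS0a.stub_entropyModulus`, conditionally on the fine-scale LLN at time `t`. -/
theorem stub_fsEntropyFunctionalsLLN : Sig.stub_fsEntropyFunctionalsLLN := by
  intro hEos
  obtain ⟨η₀, hη₀, F, hFan, hFeq, -⟩ := hEos
  have hcont : ContinuousOn hsExcessFreeEnergy (Ico 0 η₀) :=
    (hFan.continuousOn.mono fun x hx => ⟨by linarith [hx.1], hx.2⟩).congr hFeq
  refine ⟨η₀, hη₀, ?_⟩
  intro η₁ hη₁ hη₁c a₀ θ₀ u₀ ha hθ hu ha0 hθ0
  refine ⟨1 / 2, one_half_pos, ?_⟩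
  intro σ hσ hσlt T ρ θ u hsol hguard Φ _hLLN ℓ hℓ _hℓ0 _hℓ3 _τ _hτ a b hab _φ _hφ _hφ0
  have hσ2 : σ ≤ 1 / 2 := hσlt.le
  have hP : ∀ N, IsProbabilityMeasure (localGibbsLaw σ a₀ u₀ θ₀ N (Φ N)) := fun N =>
    isProbabilityMeasure_localGibbsLaw ha hθ hu ha0 hθ0 hσ2 N (Φ N)
  dsimp only [Cge1t]
  intro t ht hconv
  -- the time-`t` slices
  have hρc : Continuous (ρ t) := (hsol.smooth_density.isSmooth_slice ht).continuous
  have huc : Continuous (u t) := (hsol.smooth_velocity.isSmooth_slice ht).continuous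
  have hθc : Continuous (θ t) := (hsol.smooth_temperature.isSmooth_slice ht).continuous
  have hmc : Continuous fun x => ρ t x • u t x := hρc.smul huc
  have hEc : Continuous fun x => totalEnergyDensity (ρ t x) (u t x) (θ t x) := by
    unfold totalEnergyDensity; fun_prop
  have hρpos : ∀ x, 0 < ρ t x := hsol.density_pos t ht
  have hθpos : ∀ x, 0 < θ t x := hsol.temperature_pos t ht
  -- the compact set of base states and the band condition
  set pmap : T3 → ℝ × V3 × ℝ := fun x =>
    (ρ t x, ρ t x • u t x, totalEnergyDensity (ρ t x) (u t x) (θ t x)) with hpmap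
  have hK : IsCompact (range pmap) := isCompact_range (hρc.prodMk (hmc.prodMk hEc))
  have hband : ∀ p ∈ range pmap, 0 < p.1 ∧ p.1 * σ ^ 3 < η₁ ∧ 0 < boxTemp p.1 p.2.1 p.2.2 := by
    rintro p ⟨x, rfl⟩
    refine ⟨hρpos x, (hguard t ht x).trans_lt (by linarith), ?_⟩
    show 0 < boxTemp (ρ t x) (ρ t x • u t x) (totalEnergyDensity (ρ t x) (u t x) (θ t x))
    rw [boxTemp_consState (hρpos x).ne']; exact hθpos x
  -- the clamped cut entropy as a function of the state, and its modulus (landed S0a)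
  set G : ℝ × V3 × ℝ → ℝ := fun q =>
    clamp a b (cutEntropy σ η₁ q.1 (boxTemp q.1 q.2.1 q.2.2)) with hG
  have hGM : ∀ q, |G q| ≤ max |a| |b| := fun q => abs_clamp_le hab.le _
  have hM0 : 0 ≤ max |a| |b| := (abs_nonneg _).trans (le_max_left _ _)
  have hGp : ∀ x, G (pmap x) = clamp a b (cutEntropy σ η₁ (ρ t x) (θ t x)) := fun x => by
    simp only [hG, hpmap, boxTemp_consState (hρpos x).ne']
  have hmod : ∀ ε : ℝ, 0 < ε → ∃ δ : ℝ, 0 < δ ∧ ∀ p ∈ range pmap, ∀ q : ℝ × V3 × ℝ,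
      dist q p < δ → |G q - G p| < ε := fun ε hε =>
    Summit.AtomisticToContinuum.HydrodynamicLimit.Theorems.EABirthS0a.stub_entropyModulus η₀ hη₀
      hcont σ η₁ a b hσ hη₁ hη₁c (range pmap) hK hband ε hε
  -- measurability and integrability in the centre variable
  have hmeas := fun N z => measurable_boxFields σ ℓ Φ N t z
  have hint := fun N z => integrable_boxFields σ Φ N (hℓ N).1.le t z
  have hDn0 := fun N z x => boxDensity_nonneg σ Φ N (hℓ N).1.le t z x
  have hGm : ∀ N z, Measurable fun x => boxClampedEntropy σ η₁ ℓ Φ a b N t z x := fun N z =>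
    measurable_clamp_cutEntropy (hmeas N z).1
      (measurable_boxTemp (hmeas N z).1 (hmeas N z).2.1 (hmeas N z).2.2) (hDn0 N z)
      hcont hσ.le hη₁.le hη₁c a b
  have hGbd : ∀ N z, ∀ᵐ x : T3, ‖boxClampedEntropy σ η₁ ℓ Φ a b N t z x‖ ≤ max |a| |b| :=
    fun N z => ae_of_all _ fun x => (Real.norm_eq_abs _).trans_le (hGM (boxDensity σ ℓ Φ N t z x,
      boxMomentum σ ℓ Φ N t z x, boxEnergy σ ℓ Φ N t z x))
  have hgm : Measurable fun x => clamp a b (cutEntropy σ η₁ (ρ t x) (θ t x)) :=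
    measurable_clamp_cutEntropy hρc.measurable hθc.measurable (fun x => (hρpos x).le) hcont
      hσ.le hη₁.le hη₁c a b
  have hgbd : ∀ᵐ x : T3, ‖clamp a b (cutEntropy σ η₁ (ρ t x) (θ t x))‖ ≤ max |a| |b| :=
    ae_of_all _ fun x => (Real.norm_eq_abs _).trans_le (abs_clamp_le hab.le _)
  have hdevi : ∀ N z, Integrable fun x =>
      |boxDensity σ ℓ Φ N t z x - ρ t x| + ‖boxMomentum σ ℓ Φ N t z x - ρ t x • u t x‖ +
        |boxEnergy σ ℓ Φ N t z x - totalEnergyDensity (ρ t x) (u t x) (θ t x)| := fun N z =>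
    (((hint N z).1.sub' (integrable_of_continuous_T3 hρc)).abs.fun_add
      ((hint N z).2.1.sub' (integrable_of_continuous_T3 hmc)).norm).fun_add
      ((hint N z).2.2.sub' (integrable_of_continuous_T3 hEc)).abs
  refine ⟨fun ψ hψ => ?_, fun Ψ hΨ => ?_⟩
  · /- ### the density-weighted entropy functional `ρ̂ Z(ŝ) ψ` -/
    obtain ⟨R, hR0, hR⟩ := exists_forall_abs_le_of_continuous hρc
    obtain ⟨B, hB0, hB⟩ := exists_forall_abs_le_of_continuous hψ
    have hbd : ∀ᵐ x : T3, ‖ψ x‖ ≤ B := ae_of_all _ fun x => (Real.norm_eq_abs _).trans_le (hB x)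
    have hfi : ∀ N z, Integrable fun x =>
        boxDensity σ ℓ Φ N t z x * boxClampedEntropy σ η₁ ℓ Φ a b N t z x * ψ x := fun N z =>
      ((hint N z).1.mul_bdd (hGm N z).aestronglyMeasurable (hGbd N z)).mul_bdd
        hψ.aestronglyMeasurable hbd
    have hgi : Integrable fun x => ρ t x * clamp a b (cutEntropy σ η₁ (ρ t x) (θ t x)) * ψ x :=
      ((integrable_of_continuous_T3 hρc).mul_bdd hgm.aestronglyMeasurable hgbd).mul_bdd
        hψ.aestronglyMeasurable hbd
    -- the pointwise estimate
    have hpt : ∀ ε : ℝ, 0 < ε → ∃ C : ℝ, 0 ≤ C ∧ ∀ (N : ℕ)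
        (z : Literature.Analysis.FluidPDE.Config (N + 1) (Fin 3) T3) (x : T3),
        |boxDensity σ ℓ Φ N t z x * boxClampedEntropy σ η₁ ℓ Φ a b N t z x * ψ x -
            ρ t x * clamp a b (cutEntropy σ η₁ (ρ t x) (θ t x)) * ψ x| ≤
          ε + C * (|boxDensity σ ℓ Φ N t z x - ρ t x| +
            ‖boxMomentum σ ℓ Φ N t z x - ρ t x • u t x‖ +
            |boxEnergy σ ℓ Φ N t z x - totalEnergyDensity (ρ t x) (u t x) (θ t x)|) := by
      intro ε hε
      have hε₁ : 0 < ε / (B * R + 1) := div_pos hε (by positivity)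
      obtain ⟨δ, hδ, hmodK⟩ := hmod (ε / (B * R + 1)) hε₁
      refine ⟨B * (max |a| |b| + 2 * max |a| |b| / δ * R), by positivity, fun N z x => ?_⟩
      set q : ℝ × V3 × ℝ := (boxDensity σ ℓ Φ N t z x, boxMomentum σ ℓ Φ N t z x,
        boxEnergy σ ℓ Φ N t z x) with hq
      set D : ℝ := |boxDensity σ ℓ Φ N t z x - ρ t x| +
        ‖boxMomentum σ ℓ Φ N t z x - ρ t x • u t x‖ +
        |boxEnergy σ ℓ Φ N t z x - totalEnergyDensity (ρ t x) (u t x) (θ t x)| with hD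
      have hGG : |G q - G (pmap x)| ≤ ε / (B * R + 1) + 2 * max |a| |b| / δ * D :=
        abs_sub_le_of_modulus (hGM q) (hGM (pmap x)) hδ hε₁.le
          (fun h => hmodK (pmap x) ⟨x, rfl⟩ q h) (dist_le_sum3 q (pmap x))
      have hrD : |boxDensity σ ℓ Φ N t z x - ρ t x| ≤ D := by
        rw [hD]
        linarith [norm_nonneg (boxMomentum σ ℓ Φ N t z x - ρ t x • u t x),
          abs_nonneg (boxEnergy σ ℓ Φ N t z x - totalEnergyDensity (ρ t x) (u t x) (θ t x))]
      have hmain := abs_mul_mul_sub_le (r := boxDensity σ ℓ Φ N t z x) (p := ψ x) (hGM q) hGG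
        hrD (hR x) (hB x) hε₁.le (by positivity)
      have hsmall : B * R * (ε / (B * R + 1)) ≤ ε := by
        rw [← mul_div_assoc, div_le_iff₀ (by positivity)]
        nlinarith [mul_nonneg hB0 hR0]
      have hGq : boxClampedEntropy σ η₁ ℓ Φ a b N t z x = G q := rfl
      rw [hGq, ← hGp x]
      linarith
    -- assembly
    exact tendsto_lintegral_abs_integral_sub (fun N => localGibbsLaw σ a₀ u₀ θ₀ N (Φ N)) hP volume
      (fun N z x => boxDensity σ ℓ Φ N t z x * boxClampedEntropy σ η₁ ℓ Φ a b N t z x * ψ x)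
      (fun x => ρ t x * clamp a b (cutEntropy σ η₁ (ρ t x) (θ t x)) * ψ x)
      (fun N z x => |boxDensity σ ℓ Φ N t z x - ρ t x| +
        ‖boxMomentum σ ℓ Φ N t z x - ρ t x • u t x‖ +
        |boxEnergy σ ℓ Φ N t z x - totalEnergyDensity (ρ t x) (u t x) (θ t x)|)
      hconv hfi hgi hdevi (fun N z x => by positivity) hpt
  · /- ### the entropy flux functional `Z(ŝ) m̂·Ψ` -/
    obtain ⟨Rm, hRm0, hRm⟩ := exists_forall_abs_le_of_continuous hmc.norm
    obtain ⟨S, hS0, hS⟩ := exists_forall_abs_le_of_continuous hΨ.norm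
    replace hRm : ∀ x, ‖ρ t x • u t x‖ ≤ Rm := fun x => (le_abs_self _).trans (hRm x)
    replace hS : ∀ x, ‖Ψ x‖ ≤ S := fun x => (le_abs_self _).trans (hS x)
    have hic : Continuous fun x => inner ℝ (ρ t x • u t x) (Ψ x) := hmc.inner hΨ
    have hfi : ∀ N z, Integrable fun x =>
        boxClampedEntropy σ η₁ ℓ Φ a b N t z x * inner ℝ (boxMomentum σ ℓ Φ N t z x) (Ψ x) := by
      intro N z
      refine Integrable.bdd_mul ?_ (hGm N z).aestronglyMeasurable (hGbd N z)
      refine Integrable.mono' ((hint N z).2.1.norm.mul_const S)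
        ((hmeas N z).2.1.inner hΨ.measurable).aestronglyMeasurable (ae_of_all _ fun x => ?_)
      rw [Real.norm_eq_abs]
      exact (abs_real_inner_le_norm _ _).trans
        (mul_le_mul_of_nonneg_left (hS x) (norm_nonneg _))
    have hgi : Integrable fun x =>
        clamp a b (cutEntropy σ η₁ (ρ t x) (θ t x)) * inner ℝ (ρ t x • u t x) (Ψ x) :=
      (integrable_of_continuous_T3 hic).bdd_mul hgm.aestronglyMeasurable hgbd
    -- the pointwise estimate
    have hpt : ∀ ε : ℝ, 0 < ε → ∃ C : ℝ, 0 ≤ C ∧ ∀ (N : ℕ)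
        (z : Literature.Analysis.FluidPDE.Config (N + 1) (Fin 3) T3) (x : T3),
        |boxClampedEntropy σ η₁ ℓ Φ a b N t z x * inner ℝ (boxMomentum σ ℓ Φ N t z x) (Ψ x) -
            clamp a b (cutEntropy σ η₁ (ρ t x) (θ t x)) * inner ℝ (ρ t x • u t x) (Ψ x)| ≤
          ε + C * (|boxDensity σ ℓ Φ N t z x - ρ t x| +
            ‖boxMomentum σ ℓ Φ N t z x - ρ t x • u t x‖ +
            |boxEnergy σ ℓ Φ N t z x - totalEnergyDensity (ρ t x) (u t x) (θ t x)|) := by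
      intro ε hε
      have hε₁ : 0 < ε / (S * Rm + 1) := div_pos hε (by positivity)
      obtain ⟨δ, hδ, hmodK⟩ := hmod (ε / (S * Rm + 1)) hε₁
      refine ⟨S * (max |a| |b| + 2 * max |a| |b| / δ * Rm), by positivity, fun N z x => ?_⟩
      set q : ℝ × V3 × ℝ := (boxDensity σ ℓ Φ N t z x, boxMomentum σ ℓ Φ N t z x,
        boxEnergy σ ℓ Φ N t z x) with hq
      set D : ℝ := |boxDensity σ ℓ Φ N t z x - ρ t x| +
        ‖boxMomentum σ ℓ Φ N t z x - ρ t x • u t x‖ +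
        |boxEnergy σ ℓ Φ N t z x - totalEnergyDensity (ρ t x) (u t x) (θ t x)| with hD
      have hD0 : 0 ≤ D := by positivity
      have hGG : |G q - G (pmap x)| ≤ ε / (S * Rm + 1) + 2 * max |a| |b| / δ * D :=
        abs_sub_le_of_modulus (hGM q) (hGM (pmap x)) hδ hε₁.le
          (fun h => hmodK (pmap x) ⟨x, rfl⟩ q h) (dist_le_sum3 q (pmap x))
      have hmD : ‖boxMomentum σ ℓ Φ N t z x - ρ t x • u t x‖ ≤ D := by
        rw [hD]
        linarith [abs_nonneg (boxDensity σ ℓ Φ N t z x - ρ t x),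
          abs_nonneg (boxEnergy σ ℓ Φ N t z x - totalEnergyDensity (ρ t x) (u t x) (θ t x))]
      have hr : |inner ℝ (boxMomentum σ ℓ Φ N t z x) (Ψ x) - inner ℝ (ρ t x • u t x) (Ψ x)| ≤
          S * D := by
        rw [← inner_sub_left]
        calc |inner ℝ (boxMomentum σ ℓ Φ N t z x - ρ t x • u t x) (Ψ x)|
            ≤ ‖boxMomentum σ ℓ Φ N t z x - ρ t x • u t x‖ * ‖Ψ x‖ := abs_real_inner_le_norm _ _
          _ ≤ D * S := mul_le_mul hmD (hS x) (norm_nonneg _) hD0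
          _ = S * D := mul_comm _ _
      have hR : |inner ℝ (ρ t x • u t x) (Ψ x)| ≤ S * Rm := by
        calc |inner ℝ (ρ t x • u t x) (Ψ x)| ≤ ‖ρ t x • u t x‖ * ‖Ψ x‖ := abs_real_inner_le_norm _ _
          _ ≤ Rm * S := mul_le_mul (hRm x) (hS x) (norm_nonneg _) hRm0
          _ = S * Rm := mul_comm _ _
      have hmain := abs_mul_sub_mul_le (hGM q) hGG hr hR hε₁.le (by positivity) hD0
      have hsmall : S * Rm * (ε / (S * Rm + 1)) ≤ ε := by
        rw [← mul_div_assoc, div_le_iff₀ (by positivity)]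
        nlinarith [mul_nonneg hS0 hRm0]
      have hGq : boxClampedEntropy σ η₁ ℓ Φ a b N t z x = G q := rfl
      rw [hGq, ← hGp x]
      linarith
    -- assembly
    exact tendsto_lintegral_abs_integral_sub (fun N => localGibbsLaw σ a₀ u₀ θ₀ N (Φ N)) hP volume
      (fun N z x => boxClampedEntropy σ η₁ ℓ Φ a b N t z x * inner ℝ (boxMomentum σ ℓ Φ N t z x) (Ψ x))
      (fun x => clamp a b (cutEntropy σ η₁ (ρ t x) (θ t x)) * inner ℝ (ρ t x • u t x) (Ψ x))
      (fun N z x => |boxDensity σ ℓ Φ N t z x - ρ t x| +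
        ‖boxMomentum σ ℓ Φ N t z x - ρ t x • u t x‖ +
        |boxEnergy σ ℓ Φ N t z x - totalEnergyDensity (ρ t x) (u t x) (θ t x)|)
      hconv hfi hgi hdevi (fun N z x => by positivity) hpt

end Summit.AtomisticToContinuum.HydrodynamicLimit.Theorems.EABirthFS1

end
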